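import Mathlib.Algebra.Ring.GeomSum
import Mathlib.Data.Nat.ModEq
import Mathlib.Analysis.SpecialFunctions.Pow.Real
import Mathlib.Algebra.Order.BigOperators.Group.Finset
import Mathlib.Algebra.BigOperators.Ring.Finset
import Mathlib.Data.Nat.Bitwise
import HarnessLib

/-!
# Prime dilates of gap-separated Walsh characters decorrelate, I: cancellation identity, CRT mean,
# shifted Riemann sums (line `Sketch` of crux `DigitPolyUniformity`, stmt-QuantumAdvantage-1392)

For odd coprime `p, q` and a binary digit position `i`, the digits of the two dilates satisfy the
CANCELLATION IDENTITY `(−1)^{bit_i(px)} (−1)^{bit_i(qx)} = (−1)^{⌊p a/2^i⌋ + ⌊q a/2^i⌋}`,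
`a = x mod 2^i` (the digit `x_i` drops out). Hence dilate correlations of Walsh characters are
multiple correlations of the step function `σ(u) = (−1)^{⌊pu⌋+⌊qu⌋}` along the doubling map
(Riesz products). This file proves the single-scale inputs:

* `neg_one_pow_div_mul_neg_one_pow_div` — the cancellation identity;
* `sum_neg_one_pow_div_add_div` — `Σ_{c < pq} (−1)^{⌊c/q⌋+⌊c/p⌋} = 1` (CRT; i.e. `∫σ = 1/(pq)`);
* `abs_coarseSum_sub_le` — shifted coarse Riemann sums of `σ`:
  `|Σ_{y<2^G} σ((a + 2^s y)/2^{s+G}) − 2^G/(pq)| ≤ 2(p+q)` for `a < 2^s` (refine to the complete grid of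
  `pq·2^{s+G}` points, on which the sum is exact, and count the `≤ p + q` dyadic cells containing a
  jump of `σ`).

Part II (`MobiusLadderDigitPolyUniformityWalshGapped.lean`) assembles the gap-separated Riesz product
and the dilate-correlation statement `stub_walshGapped` of the skeleton
`Summits/QuantumAdvantage/QuantumAdvantage/Cruxes/DigitPolyUniformity/Lines/Sketch.lean`.
All elementary (natural-number division, parity, CRT counting); no named facts.
-/

open Finset

namespace Summit.QuantumAdvantage.DigitPolyUniformity.Sketch

/-! ### Signs of binary digits -/

/-- The sign of the `i`-th binary digit of `y` is `(−1)^{⌊y/2^i⌋}`. [folklore] -/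
theorem ite_testBit_eq_neg_one_pow (y i : ℕ) :
    (if Nat.testBit y i then (-1 : ℝ) else 1) = (-1) ^ (y / 2 ^ i) := by
  rw [Nat.testBit_eq_decide_div_mod_eq]
  rcases Nat.even_or_odd (y / 2 ^ i) with h | h
  · rw [h.neg_one_pow]
    have : y / 2 ^ i % 2 = 0 := Nat.even_iff.mp h
    simp [this]
  · rw [h.neg_one_pow]
    have : y / 2 ^ i % 2 = 1 := Nat.odd_iff.mp h
    simp [this]

/-- `(−1)^(m·k) = (−1)^k` for odd `m`. [folklore] -/
theorem neg_one_pow_odd_mul {m : ℕ} (hm : Odd m) (k : ℕ) : ((-1 : ℝ) ^ (m * k)) = (-1) ^ k := by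
  rw [pow_mul, hm.neg_one_pow]

/-- **The cancellation identity.** For odd `p, q`:
`(−1)^{⌊px/2^i⌋} (−1)^{⌊qx/2^i⌋} = (−1)^{⌊p a/2^i⌋ + ⌊q a/2^i⌋}` with `a = x mod 2^i` — the `i`-th digit
of `x` drops out of the product of the `i`-th digits of the two dilates. [folklore] -/
theorem neg_one_pow_div_mul_neg_one_pow_div {p q : ℕ} (hp : Odd p) (hq : Odd q) (x i : ℕ) :
    (-1 : ℝ) ^ (p * x / 2 ^ i) * (-1) ^ (q * x / 2 ^ i) =
      (-1) ^ (p * (x % 2 ^ i) / 2 ^ i + q * (x % 2 ^ i) / 2 ^ i) := by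
  have h2 : 0 < 2 ^ i := Nat.two_pow_pos i
  have hx : x = x % 2 ^ i + 2 ^ i * (x / 2 ^ i) := (Nat.mod_add_div x (2 ^ i)).symm
  have hpx : p * x / 2 ^ i = p * (x % 2 ^ i) / 2 ^ i + p * (x / 2 ^ i) := by
    conv_lhs => rw [hx, mul_add, show p * (2 ^ i * (x / 2 ^ i)) = 2 ^ i * (p * (x / 2 ^ i)) by ring]
    exact Nat.add_mul_div_left _ _ h2
  have hqx : q * x / 2 ^ i = q * (x % 2 ^ i) / 2 ^ i + q * (x / 2 ^ i) := by
    conv_lhs => rw [hx, mul_add, show q * (2 ^ i * (x / 2 ^ i)) = 2 ^ i * (q * (x / 2 ^ i)) by ring]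
    exact Nat.add_mul_div_left _ _ h2
  rw [hpx, hqx, ← pow_add]
  have he : Even ((p + q) * (x / 2 ^ i)) := (hp.add_odd hq).mul_right _
  calc (-1 : ℝ) ^ (p * (x % 2 ^ i) / 2 ^ i + p * (x / 2 ^ i) + (q * (x % 2 ^ i) / 2 ^ i + q * (x / 2 ^ i)))
      = (-1) ^ (p * (x % 2 ^ i) / 2 ^ i + q * (x % 2 ^ i) / 2 ^ i) *
          (-1) ^ ((p + q) * (x / 2 ^ i)) := by
        rw [← pow_add]; congr 1; ring
    _ = _ := by rw [he.neg_one_pow, mul_one]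

/-! ### The CRT evaluation `Σ_{c<pq} (−1)^{⌊c/q⌋+⌊c/p⌋} = 1` -/

/-- For odd `q`: `(−1)^{⌊c/q⌋} = (−1)^{c + c mod q}`. [folklore] -/
theorem neg_one_pow_div_eq {q : ℕ} (hq : Odd q) (c : ℕ) :
    (-1 : ℝ) ^ (c / q) = (-1) ^ (c + c % q) := by
  have h : c + c % q = q * (c / q) + 2 * (c % q) := by
    have := Nat.mod_add_div c q
    omega
  rw [h, pow_add, neg_one_pow_odd_mul hq, pow_mul]
  norm_num

/-- `Σ_{a<p} (−1)^a = 1` for odd `p`. [folklore] -/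
theorem sum_range_neg_one_pow_of_odd {p : ℕ} (hp : Odd p) :
    ∑ a ∈ range p, (-1 : ℝ) ^ a = 1 := by
  rw [neg_one_geom_sum, if_neg (Nat.not_even_iff_odd.mpr hp)]

/-- CRT counting: for coprime `p, q` and `a < p`, `b < q` there is exactly one `c < pq` with
`c ≡ a (p)`, `c ≡ b (q)`. [folklore] -/
theorem card_filter_mod_eq_mod_eq {p q : ℕ} (hpq : p.Coprime q) (hp : 0 < p) (hq : 0 < q)
    {a b : ℕ} (ha : a < p) (hb : b < q) :
    ((range (p * q)).filter (fun c => c % p = a ∧ c % q = b)).card = 1 := by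
  rw [Finset.card_eq_one]
  set z := (Nat.chineseRemainder hpq a b : ℕ) with hz
  have hzp : z % p = a := by
    have := (Nat.chineseRemainder hpq a b).prop.1
    rw [← hz] at this
    rw [Nat.ModEq] at this
    rw [this, Nat.mod_eq_of_lt ha]
  have hzq : z % q = b := by
    have := (Nat.chineseRemainder hpq a b).prop.2
    rw [← hz] at this
    rw [Nat.ModEq] at this
    rw [this, Nat.mod_eq_of_lt hb]
  have hzlt : z < p * q := Nat.chineseRemainder_lt_mul hpq a b hp.ne' hq.ne'
  refine ⟨z, ?_⟩
  ext c
  simp only [Finset.mem_filter, Finset.mem_range, Finset.mem_singleton]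
  constructor
  · rintro ⟨hc, hca, hcb⟩
    have h1 : c ≡ a [MOD p] := by rw [Nat.ModEq, hca, Nat.mod_eq_of_lt ha]
    have h2 : c ≡ b [MOD q] := by rw [Nat.ModEq, hcb, Nat.mod_eq_of_lt hb]
    have hu := Nat.chineseRemainder_modEq_unique hpq h1 h2
    rw [← hz, Nat.ModEq, Nat.mod_eq_of_lt hc, Nat.mod_eq_of_lt hzlt] at hu
    exact hu
  · rintro rfl
    exact ⟨hzlt, hzp, hzq⟩

/-- **`Σ_{c<pq} (−1)^{⌊c/q⌋ + ⌊c/p⌋} = 1`** for odd coprime `p, q` (the exact mean `1/(pq)` of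
`σ(u) = (−1)^{⌊pu⌋+⌊qu⌋}`): by `(−1)^{⌊c/q⌋} = (−1)^{c + c mod q}` the summand is
`(−1)^{c mod p + c mod q}`, and CRT makes `c ↦ (c mod p, c mod q)` a bijection onto
`[0,p) × [0,q)`, so the sum is `(Σ_{a<p}(−1)^a)(Σ_{b<q}(−1)^b) = 1`. [folklore] -/
theorem sum_neg_one_pow_div_add_div {p q : ℕ} (hp : Odd p) (hq : Odd q) (hpq : p.Coprime q) :
    ∑ c ∈ range (p * q), (-1 : ℝ) ^ (c / q + c / p) = 1 := by
  have hp0 : 0 < p := hp.pos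
  have hq0 : 0 < q := hq.pos
  have hsum : ∀ c, (-1 : ℝ) ^ (c / q + c / p) = (-1) ^ (c % p) * (-1) ^ (c % q) := by
    intro c
    rw [pow_add, neg_one_pow_div_eq hq, neg_one_pow_div_eq hp, pow_add, pow_add]
    have : ((-1 : ℝ) ^ c) * ((-1) ^ c) = 1 := by rw [← pow_add, ← two_mul, pow_mul]; norm_num
    calc (-1 : ℝ) ^ c * (-1) ^ (c % q) * ((-1) ^ c * (-1) ^ (c % p))
        = ((-1 : ℝ) ^ c * (-1) ^ c) * ((-1) ^ (c % p) * (-1) ^ (c % q)) := by ring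
      _ = _ := by rw [this, one_mul]
  simp_rw [hsum]
  -- regroup by the value of `(c % p, c % q)`
  rw [← Finset.sum_fiberwise_of_maps_to (g := fun c => (c % p, c % q))
    (t := range p ×ˢ range q) (fun c _ => by
      simp only [Finset.mem_product, Finset.mem_range]
      exact ⟨Nat.mod_lt _ hp0, Nat.mod_lt _ hq0⟩)]
  rw [Finset.sum_product]
  have hinner : ∀ a ∈ range p, ∀ b ∈ range q,
      ∑ c ∈ (range (p * q)).filter (fun c => (c % p, c % q) = (a, b)),
        (-1 : ℝ) ^ (c % p) * (-1) ^ (c % q) = (-1) ^ a * (-1) ^ b := by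
    intro a ha b hb
    have hcard := card_filter_mod_eq_mod_eq hpq hp0 hq0 (Finset.mem_range.mp ha)
      (Finset.mem_range.mp hb)
    have heq : (range (p * q)).filter (fun c => (c % p, c % q) = (a, b)) =
        (range (p * q)).filter (fun c => c % p = a ∧ c % q = b) := by
      refine Finset.filter_congr fun c _ => ?_
      simp only [Prod.mk.injEq]
    rw [heq]
    obtain ⟨z, hz⟩ := Finset.card_eq_one.mp hcard
    rw [hz, Finset.sum_singleton]
    have hzmem : z ∈ (range (p * q)).filter (fun c => c % p = a ∧ c % q = b) := by
      rw [hz]; exact Finset.mem_singleton_self z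
    rw [Finset.mem_filter] at hzmem
    rw [hzmem.2.1, hzmem.2.2]
  rw [Finset.sum_congr rfl fun a ha => Finset.sum_congr rfl fun b hb => hinner a ha b hb]
  simp_rw [← Finset.mul_sum]
  rw [← Finset.sum_mul, sum_range_neg_one_pow_of_odd hp, sum_range_neg_one_pow_of_odd hq, one_mul]

/-! ### Riemann sums of `σ` on shifted dyadic grids -/

/-- Splitting a sum over `range (m * n)` into `n` blocks of length `m`. [folklore] -/
theorem sum_range_mul_split (f : ℕ → ℝ) (m n : ℕ) :
    ∑ c ∈ range (m * n), f c = ∑ y ∈ range n, ∑ r ∈ range m, f (m * y + r) := by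
  induction n with
  | zero => simp
  | succ n ih =>
    rw [Nat.mul_succ, Finset.sum_range_add, ih, Finset.sum_range_succ]

/-- The fine complete sum: `Σ_{c < 2^e·(pq)} (−1)^{⌊c/(2^e q)⌋ + ⌊c/(2^e p)⌋} = 2^e` for odd coprime
`p, q` (each of the `pq` coarse cells of length `2^e` has constant sign, and the coarse signs sum to
`1` by `sum_neg_one_pow_div_add_div`). [folklore] -/
theorem fineSum_eq {p q : ℕ} (hp : Odd p) (hq : Odd q) (hpq : p.Coprime q) (e : ℕ) :
    ∑ c ∈ range (2 ^ e * (p * q)), (-1 : ℝ) ^ (c / (2 ^ e * q) + c / (2 ^ e * p)) = 2 ^ e := by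
  have h2 : 0 < 2 ^ e := Nat.two_pow_pos e
  rw [sum_range_mul_split]
  have hcell : ∀ y r, r < 2 ^ e →
      (2 ^ e * y + r) / (2 ^ e * q) + (2 ^ e * y + r) / (2 ^ e * p) = y / q + y / p := by
    intro y r hr
    have h1 : (2 ^ e * y + r) / 2 ^ e = y := by
      rw [show 2 ^ e * y + r = r + 2 ^ e * y by ring, Nat.add_mul_div_left _ _ h2,
        Nat.div_eq_of_lt hr, zero_add]
    rw [← Nat.div_div_eq_div_mul, ← Nat.div_div_eq_div_mul, h1]
  calc ∑ y ∈ range (p * q), ∑ r ∈ range (2 ^ e), (-1 : ℝ) ^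
        ((2 ^ e * y + r) / (2 ^ e * q) + (2 ^ e * y + r) / (2 ^ e * p))
      = ∑ y ∈ range (p * q), ∑ r ∈ range (2 ^ e), (-1 : ℝ) ^ (y / q + y / p) := by
        refine Finset.sum_congr rfl fun y _ => Finset.sum_congr rfl fun r hr => ?_
        rw [hcell y r (Finset.mem_range.mp hr)]
    _ = ∑ y ∈ range (p * q), (2 : ℝ) ^ e * (-1 : ℝ) ^ (y / q + y / p) := by
        refine Finset.sum_congr rfl fun y _ => ?_
        rw [Finset.sum_const, Finset.card_range, nsmul_eq_mul]
        push_cast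
        ring
    _ = 2 ^ e := by rw [← Finset.mul_sum, sum_neg_one_pow_div_add_div hp hq hpq, mul_one]

/-- Quotients are constant on an interval free of multiples: if no multiple of `K` lies in
`(A, A + ℓ)`, then `(A + r)/K = A/K` for `r < ℓ`. [folklore] -/
theorem div_eq_div_of_no_multiple {K A ℓ r : ℕ} (hK : 0 < K) (hr : r < ℓ)
    (hno : ∀ t, ¬ (A < K * t ∧ K * t < A + ℓ)) : (A + r) / K = A / K := by
  refine le_antisymm ?_ (Nat.div_le_div_right (Nat.le_add_right A r))
  by_contra hlt
  push Not at hlt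
  -- the multiple `K * ((A + r) / K)` lies in `(A, A + ℓ)`
  apply hno ((A + r) / K)
  constructor
  · -- `A < K * ((A+r)/K)` since `A / K < (A + r) / K`
    have h1 : A / K + 1 ≤ (A + r) / K := hlt
    have h2 : A < K * (A / K + 1) := by
      have := Nat.lt_div_mul_add (a := A) hK
      rw [mul_comm] at this
      linarith [Nat.div_add_mod A K, Nat.mod_lt A hK]
    exact lt_of_lt_of_le h2 (Nat.mul_le_mul_left K h1)
  · calc K * ((A + r) / K) ≤ A + r := Nat.mul_div_le (A + r) K
      _ < A + ℓ := by omega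

/-- Counting the cells that contain a multiple of `K` in their interior: among the cells
`[m y, m y + m)`, `y < n`, at most `(m n) / K + 1`... precisely, their number is at most the total
increase `(m n)/K − 0` of the quotient, bounded here by any `B` with `m * n ≤ K * B`. [folklore] -/
theorem card_badCells_le {K m n B : ℕ} (hK : 0 < K) (hB : m * n ≤ K * B)
    [DecidablePred (fun y => ∃ t, m * y < K * t ∧ K * t < m * y + m)] :
    ((range n).filter (fun y => ∃ t, m * y < K * t ∧ K * t < m * y + m)).card ≤ B := by
  -- indicator of a bad cell is at most the jump of `y ↦ (m y) / K`
  have hind : ∀ y ∈ range n,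
      (if (∃ t, m * y < K * t ∧ K * t < m * y + m) then (1 : ℤ) else 0) ≤
        ((m * (y + 1) / K : ℕ) : ℤ) - ((m * y / K : ℕ) : ℤ) := by
    intro y _
    split_ifs with h
    · obtain ⟨t, ht1, ht2⟩ := h
      have h1 : m * y / K < t := by
        rw [Nat.div_lt_iff_lt_mul hK]; linarith [mul_comm K t]
      have h2 : t ≤ m * (y + 1) / K := by
        rw [Nat.le_div_iff_mul_le hK]
        have : m * (y + 1) = m * y + m := by ring
        rw [this, mul_comm]; exact ht2.le
      have : (m * y / K : ℤ) + 1 ≤ (m * (y + 1) / K : ℕ) := by exact_mod_cast (h1.trans_le h2)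
      push_cast at this ⊢
      linarith
    · have : m * y / K ≤ m * (y + 1) / K :=
        Nat.div_le_div_right (Nat.mul_le_mul_left m (Nat.le_succ y))
      have : ((m * y / K : ℕ) : ℤ) ≤ ((m * (y + 1) / K : ℕ) : ℤ) := by exact_mod_cast this
      linarith
  have hsum := Finset.sum_le_sum hind
  rw [Finset.sum_range_sub (fun y => ((m * y / K : ℕ) : ℤ)) n] at hsum
  simp only [mul_zero, Nat.zero_div, Nat.cast_zero, sub_zero] at hsum
  have hcard : (((range n).filter (fun y => ∃ t, m * y < K * t ∧ K * t < m * y + m)).card : ℤ) =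
      ∑ y ∈ range n, (if (∃ t, m * y < K * t ∧ K * t < m * y + m) then (1 : ℤ) else 0) := by
    rw [Finset.sum_boole]
  have hq : m * n / K ≤ B := by
    rw [Nat.div_le_iff_le_mul_add_pred hK]
    calc m * n ≤ K * B := hB
      _ ≤ K * B + (K - 1) := Nat.le_add_right _ _
  have : (((range n).filter (fun y => ∃ t, m * y < K * t ∧ K * t < m * y + m)).card : ℤ) ≤ B := by
    rw [hcard]
    refine hsum.trans ?_
    exact_mod_cast hq
  exact_mod_cast this

/-- **Shifted coarse Riemann sums of `σ`.** For odd coprime `p, q`, `a < 2^s` and any `G`: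
`|Σ_{y<2^G} (−1)^{⌊p(a+2^s y)/2^{s+G}⌋ + ⌊q(a+2^s y)/2^{s+G}⌋} − 2^G/(pq)| ≤ 2(p+q)`.
Proof: refine to the complete grid of `pq·2^{s+G}` points (`fineSum_eq`: sum `2^{s+G}`); the coarse
point `pq(a + 2^s y)` lies in the cell `[pq2^s y, pq2^s(y+1))`, on which both quotients are constant
unless the cell contains a multiple of `2^{s+G}q` or of `2^{s+G}p` in its interior (at most `p + q`
cells, `card_badCells_le`). [folklore] -/
theorem abs_coarseSum_sub_le {p q : ℕ} (hp : Odd p) (hq : Odd q) (hpq : p.Coprime q)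
    (s G a : ℕ) (ha : a < 2 ^ s) :
    |∑ y ∈ range (2 ^ G), (-1 : ℝ) ^ (p * (a + 2 ^ s * y) / 2 ^ (s + G) +
        q * (a + 2 ^ s * y) / 2 ^ (s + G)) - 2 ^ G / (p * q)| ≤ 2 * (p + q) := by
  have hp0 : 0 < p := hp.pos
  have hq0 : 0 < q := hq.pos
  have hp0r : (0 : ℝ) < p := by exact_mod_cast hp0
  have hq0r : (0 : ℝ) < q := by exact_mod_cast hq0
  have h2 : 0 < 2 ^ (s + G) := Nat.two_pow_pos _
  set m : ℕ := p * q * 2 ^ s with hmdef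
  have hm0 : 0 < m := by positivity
  -- the fine sum over the whole period, as blocks over the cells
  set f : ℕ → ℝ := fun c => (-1 : ℝ) ^ (c / (2 ^ (s + G) * q) + c / (2 ^ (s + G) * p)) with hfdef
  have hfine : ∑ c ∈ range (m * 2 ^ G), f c = 2 ^ (s + G) := by
    have : m * 2 ^ G = 2 ^ (s + G) * (p * q) := by rw [hmdef, pow_add]; ring
    rw [this]
    exact fineSum_eq hp hq hpq (s + G)
  -- the coarse summand is `f` at the point `p q (a + 2^s y) = m y + p q a` of cell `y`
  set g : ℕ → ℝ := fun y => (-1 : ℝ) ^ (p * (a + 2 ^ s * y) / 2 ^ (s + G) +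
    q * (a + 2 ^ s * y) / 2 ^ (s + G)) with hgdef
  have hga : p * q * a < m := by
    rw [hmdef]; exact Nat.mul_lt_mul_of_pos_left ha (by positivity)
  have hg : ∀ y, g y = f (m * y + p * q * a) := by
    intro y
    simp only [hgdef, hfdef]
    have hpt : m * y + p * q * a = p * q * (a + 2 ^ s * y) := by rw [hmdef]; ring
    have e1 : p * q * (a + 2 ^ s * y) / (2 ^ (s + G) * q) = p * (a + 2 ^ s * y) / 2 ^ (s + G) := by
      rw [show p * q * (a + 2 ^ s * y) = q * (p * (a + 2 ^ s * y)) by ring, mul_comm (2 ^ (s + G)) q]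
      exact Nat.mul_div_mul_left _ _ hq0
    have e2 : p * q * (a + 2 ^ s * y) / (2 ^ (s + G) * p) = q * (a + 2 ^ s * y) / 2 ^ (s + G) := by
      rw [show p * q * (a + 2 ^ s * y) = p * (q * (a + 2 ^ s * y)) by ring, mul_comm (2 ^ (s + G)) p]
      exact Nat.mul_div_mul_left _ _ hp0
    rw [hpt, e1, e2]
  -- good cells: no interior multiple of `2^(s+G) q` nor of `2^(s+G) p`
  set badq : ℕ → Prop := fun y => ∃ t, m * y < 2 ^ (s + G) * q * t ∧ 2 ^ (s + G) * q * t < m * y + m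
    with hbadq
  set badp : ℕ → Prop := fun y => ∃ t, m * y < 2 ^ (s + G) * p * t ∧ 2 ^ (s + G) * p * t < m * y + m
    with hbadp
  have hconst : ∀ y, ¬ badq y → ¬ badp y → ∀ r < m, f (m * y + r) = g y := by
    intro y hyq hyp r hr
    rw [hg y]
    simp only [hfdef]
    have hnoq : ∀ t, ¬ (m * y < 2 ^ (s + G) * q * t ∧ 2 ^ (s + G) * q * t < m * y + m) :=
      fun t ht => hyq ⟨t, ht⟩
    have hnop : ∀ t, ¬ (m * y < 2 ^ (s + G) * p * t ∧ 2 ^ (s + G) * p * t < m * y + m) :=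
      fun t ht => hyp ⟨t, ht⟩
    rw [div_eq_div_of_no_multiple (Nat.mul_pos h2 hq0) hr hnoq,
      div_eq_div_of_no_multiple (Nat.mul_pos h2 hq0) hga hnoq,
      div_eq_div_of_no_multiple (Nat.mul_pos h2 hp0) hr hnop,
      div_eq_div_of_no_multiple (Nat.mul_pos h2 hp0) hga hnop]
  -- the difference fine − m·coarse is supported on bad cells
  classical
  have hdiff : |∑ c ∈ range (m * 2 ^ G), f c - (m : ℝ) * ∑ y ∈ range (2 ^ G), g y| ≤
      2 * m * (((range (2 ^ G)).filter (fun y => badq y ∨ badp y)).card : ℝ) := by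
    rw [sum_range_mul_split, Finset.mul_sum, ← Finset.sum_sub_distrib]
    have hterm : ∀ y ∈ range (2 ^ G),
        |∑ r ∈ range m, f (m * y + r) - (m : ℝ) * g y| ≤
          if (badq y ∨ badp y) then 2 * (m : ℝ) else 0 := by
      intro y _
      split_ifs with hb
      · calc |∑ r ∈ range m, f (m * y + r) - (m : ℝ) * g y|
            ≤ |∑ r ∈ range m, f (m * y + r)| + |(m : ℝ) * g y| := abs_sub _ _
          _ ≤ (m : ℝ) + m := by
              apply add_le_add
              · calc |∑ r ∈ range m, f (m * y + r)| ≤ ∑ r ∈ range m, |f (m * y + r)| :=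
                    Finset.abs_sum_le_sum_abs _ _
                  _ ≤ ∑ r ∈ range m, (1 : ℝ) := Finset.sum_le_sum fun r _ => by
                      simp only [hfdef, abs_pow, abs_neg, abs_one, one_pow, le_refl]
                  _ = m := by simp
              · rw [abs_mul, Nat.abs_cast]
                have : |g y| ≤ 1 := by simp only [hgdef, abs_pow, abs_neg, abs_one, one_pow, le_refl]
                calc (m : ℝ) * |g y| ≤ m * 1 := mul_le_mul_of_nonneg_left this (Nat.cast_nonneg m)
                  _ = m := mul_one _
          _ = 2 * m := by ring
      · push Not at hb
        have : ∑ r ∈ range m, f (m * y + r) = (m : ℝ) * g y := by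
          rw [Finset.sum_congr rfl fun r hr => hconst y hb.1 hb.2 r (Finset.mem_range.mp hr),
            Finset.sum_const, Finset.card_range, nsmul_eq_mul]
        rw [this, sub_self, abs_zero]
    calc |∑ y ∈ range (2 ^ G), (∑ r ∈ range m, f (m * y + r) - (m : ℝ) * g y)|
        ≤ ∑ y ∈ range (2 ^ G), |∑ r ∈ range m, f (m * y + r) - (m : ℝ) * g y| :=
          Finset.abs_sum_le_sum_abs _ _
      _ ≤ ∑ y ∈ range (2 ^ G), (if (badq y ∨ badp y) then 2 * (m : ℝ) else 0) :=
          Finset.sum_le_sum hterm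
      _ = 2 * m * (((range (2 ^ G)).filter (fun y => badq y ∨ badp y)).card : ℝ) := by
          rw [← Finset.sum_filter, Finset.sum_const, nsmul_eq_mul]; ring
  -- at most `p + q` bad cells
  have hbad : (((range (2 ^ G)).filter (fun y => badq y ∨ badp y)).card : ℝ) ≤ p + q := by
    have hq' : ((range (2 ^ G)).filter (fun y => badq y)).card ≤ p := by
      apply card_badCells_le (by positivity)
      rw [hmdef, pow_add]; apply le_of_eq; ring
    have hp' : ((range (2 ^ G)).filter (fun y => badp y)).card ≤ q := by
      apply card_badCells_le (by positivity)
      rw [hmdef, pow_add]; apply le_of_eq; ring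
    have hunion : (range (2 ^ G)).filter (fun y => badq y ∨ badp y) =
        (range (2 ^ G)).filter (fun y => badq y) ∪ (range (2 ^ G)).filter (fun y => badp y) :=
      Finset.filter_or _ _ _
    rw [hunion]
    calc (((range (2 ^ G)).filter (fun y => badq y) ∪ (range (2 ^ G)).filter (fun y => badp y)).card
          : ℝ) ≤ (((range (2 ^ G)).filter (fun y => badq y)).card +
            ((range (2 ^ G)).filter (fun y => badp y)).card : ℕ) := by
          exact_mod_cast Finset.card_union_le _ _
      _ ≤ p + q := by push_cast; exact_mod_cast add_le_add hq' hp'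
  -- assemble: fine = 2^(s+G), so |2^(s+G) − m·coarse| ≤ 2 m (p+q); divide by m = pq 2^s
  have hmr : (m : ℝ) = p * q * 2 ^ s := by rw [hmdef]; push_cast; ring
  have hmpos : (0 : ℝ) < m := by exact_mod_cast hm0
  have key : |(2 : ℝ) ^ (s + G) - (m : ℝ) * ∑ y ∈ range (2 ^ G), g y| ≤ 2 * m * (p + q) := by
    rw [← hfine]
    exact hdiff.trans (by nlinarith [hbad, hmpos])
  have hdiv : |(2 : ℝ) ^ G / (p * q) - ∑ y ∈ range (2 ^ G), g y| ≤ 2 * (p + q) := by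
    have e : (2 : ℝ) ^ G / (p * q) - ∑ y ∈ range (2 ^ G), g y =
        ((2 : ℝ) ^ (s + G) - (m : ℝ) * ∑ y ∈ range (2 ^ G), g y) / m := by
      rw [hmr, pow_add]; field_simp
    rw [e, abs_div, abs_of_pos hmpos, div_le_iff₀ hmpos]
    calc |(2 : ℝ) ^ (s + G) - (m : ℝ) * ∑ y ∈ range (2 ^ G), g y| ≤ 2 * m * (p + q) := key
      _ = 2 * (p + q) * m := by ring
  rw [abs_sub_comm] at hdiv
  exact hdiv

end Summit.QuantumAdvantage.DigitPolyUniformity.Sketch
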